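import Summits.BirchSwinnertonDyer.BirchSwinnertonDyer.Theses.TameQuarticSolvent
import Summits.BirchSwinnertonDyer.BirchSwinnertonDyer.Theorems.TameQuarticSolventLowerBSD3OverSolventQuarticRamification
import HarnessLib

/-!
# Route `TameQuarticSolvent`, child crux `LowerBSD3OverSolventQuartic` (stmt-BirchSwinnertonDyer-23963): the ramification
# binder «`∀ w ∋ 3, e(w∣3) = 4`» of the item is REDUNDANT — kernel-checked against the route declaration BY NAME

HONEST FRAMING. Theorems only (no definition, no named fact, nothing asserted); a helper `--supports` item 23963, which stays
OPEN (research statement: the lower half of BSD₃ for `E_M` over the totally real quartic `M`; ideation-only per the route pen,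
bsd-wall STATUS 2026-08-28T00:24:03Z). BSD is not proved by any of this.

WHAT. `lowerBSD3OverSolventQuartic_iff_of_hasGoodReductionAt` — the route declaration
`Summit.BirchSwinnertonDyer.BirchSwinnertonDyer.Theses.TameQuarticSolvent.LowerBSD3OverSolventQuartic` is EQUIVALENT to the
same statement with the binder «`∀ w ∋ 3, w.asIdeal.ramificationIdx ℤ = 4`» deleted: on the cell (t′) at `3`, in a tower
`ℚ ⊂ K ⊂ M` with `[K:ℚ] = [M:K] = 2`, good reduction of `E_M` at every place above `3` already forces `e(w∣3) = 4` there
(`LowerBSD3OverSolventQuartic.ramificationIdx_eq_four_of_hasGoodReductionAt_quadratic_tower`, file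
`…LowerBSD3OverSolventQuarticRamification.lean`: `e_E(3) = 4 ∣ e(w∣3) ≤ [M:ℚ] = 4`). The two one-way forms are
`lowerBSD3OverSolventQuartic_of_noRamificationBinder` (trivial direction) and `noRamificationBinder_of_lowerBSD3OverSolventQuartic`.
Recorded for the pen; the item text is not touched (a β-swap would only delete a harmless binder).

References: J. H. Silverman, *AEC* VII.1 Prop. 1.3, VII.5.1; J.-P. Serre, J. Tate, Ann. of Math. 88 (1968) §2.
-/

-- D-0017: single-problem summit, so `Summit.BirchSwinnertonDyer.BirchSwinnertonDyer.…` repeats a namespace BY DESIGN.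
set_option linter.dupNamespace false

noncomputable section

open scoped NumberField

open IsDedekindDomain IsDedekindDomain.HeightOneSpectrum NumberField WeierstrassCurve
  Literature.NumberTheory.EllipticCurves Literature.NumberTheory.EllipticCurves.Rank1Residual
  Summit.BirchSwinnertonDyer.Rank1Residual.Additive

namespace Summit.BirchSwinnertonDyer.BirchSwinnertonDyer.Theorems.LowerBSD3OverSolventQuartic

/-- **Trivial direction**: the item's statement WITHOUT the ramification binder implies the route declaration
`LowerBSD3OverSolventQuartic` (drop a hypothesis). [folklore] -/
theorem lowerBSD3OverSolventQuartic_of_noRamificationBinder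
    (h : ∀ (W : WeierstrassCurve ℚ) [W.IsElliptic] [W.IsGloballyMinimal], ¬ W.HasCM → Addv W 3 →
      SubTprime W 3 → W.analyticRank = 1 →
      ∀ (K : Type) [Field K] [NumberField K] (M : Type) [Field M] [NumberField M] [Algebra K M],
      Module.finrank ℚ K = 2 → Module.finrank K M = 2 → NumberField.IsTotallyReal M →
      (∀ w : HeightOneSpectrum (𝓞 M), ((3 : ℕ) : 𝓞 M) ∈ w.asIdeal → (W.baseChange M).HasGoodReductionAt w) →
      Finite (AddCommGroup.primaryComponent (W.baseChange M).sha 3) →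
      ∀ qM : ℚ, analyticSha (W.baseChange M) = (qM : ℂ) →
      padicValRat 3 qM ≤ padicValNat 3 (Nat.card (AddCommGroup.primaryComponent (W.baseChange M).sha 3))) :
    Theses.TameQuarticSolvent.LowerBSD3OverSolventQuartic := by
  intro W _ _ hCM hadd hsub hr K _ _ M _ _ _ hK hKM hreal _ hgood hfin qM hq
  exact h W hCM hadd hsub hr K M hK hKM hreal hgood hfin qM hq

/-- **Content direction**: the route declaration `LowerBSD3OverSolventQuartic` implies the same statement WITHOUT the
ramification binder — on the cell (t′) at `3`, good reduction of `E_M` at every `w ∋ 3` of the quartic `M` (tower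
`[K:ℚ] = [M:K] = 2`) forces `w.asIdeal.ramificationIdx ℤ = 4` (`ramificationIdx_eq_four_of_hasGoodReductionAt_quadratic_tower`).
[cite: SilvermanAEC2009, Prop. VII.1.3 and VII.5.1] -/
theorem noRamificationBinder_of_lowerBSD3OverSolventQuartic
    (h : Theses.TameQuarticSolvent.LowerBSD3OverSolventQuartic) :
    ∀ (W : WeierstrassCurve ℚ) [W.IsElliptic] [W.IsGloballyMinimal], ¬ W.HasCM → Addv W 3 →
      SubTprime W 3 → W.analyticRank = 1 →
      ∀ (K : Type) [Field K] [NumberField K] (M : Type) [Field M] [NumberField M] [Algebra K M],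
      Module.finrank ℚ K = 2 → Module.finrank K M = 2 → NumberField.IsTotallyReal M →
      (∀ w : HeightOneSpectrum (𝓞 M), ((3 : ℕ) : 𝓞 M) ∈ w.asIdeal → (W.baseChange M).HasGoodReductionAt w) →
      Finite (AddCommGroup.primaryComponent (W.baseChange M).sha 3) →
      ∀ qM : ℚ, analyticSha (W.baseChange M) = (qM : ℂ) →
      padicValRat 3 qM ≤ padicValNat 3 (Nat.card (AddCommGroup.primaryComponent (W.baseChange M).sha 3)) := by
  intro W _ _ hCM hadd hsub hr K _ _ M _ _ _ hK hKM hreal hgood hfin qM hq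
  have he4 := ramificationIdx_eq_four_of_hasGoodReductionAt_quadratic_tower W hadd hsub K M hK hKM hgood
  exact h W hCM hadd hsub hr K M hK hKM hreal he4 hgood hfin qM hq

/-- **The ramification binder of item 23963 is redundant**: the route declaration
`Theses.TameQuarticSolvent.LowerBSD3OverSolventQuartic` (lower half of BSD₃ for `E_M` over every totally real quartic
`M ⊃ K ⊃ ℚ` with `e(w∣3) = 4` and good reduction at every `w ∋ 3`) is EQUIVALENT to the same statement with the binder
«`∀ w ∋ 3, w.asIdeal.ramificationIdx ℤ = 4`» deleted. [cite: SilvermanAEC2009, Prop. VII.1.3 and VII.5.1] -/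
theorem lowerBSD3OverSolventQuartic_iff_of_hasGoodReductionAt :
    Theses.TameQuarticSolvent.LowerBSD3OverSolventQuartic ↔
    ∀ (W : WeierstrassCurve ℚ) [W.IsElliptic] [W.IsGloballyMinimal], ¬ W.HasCM → Addv W 3 →
      SubTprime W 3 → W.analyticRank = 1 →
      ∀ (K : Type) [Field K] [NumberField K] (M : Type) [Field M] [NumberField M] [Algebra K M],
      Module.finrank ℚ K = 2 → Module.finrank K M = 2 → NumberField.IsTotallyReal M →
      (∀ w : HeightOneSpectrum (𝓞 M), ((3 : ℕ) : 𝓞 M) ∈ w.asIdeal → (W.baseChange M).HasGoodReductionAt w) →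
      Finite (AddCommGroup.primaryComponent (W.baseChange M).sha 3) →
      ∀ qM : ℚ, analyticSha (W.baseChange M) = (qM : ℂ) →
      padicValRat 3 qM ≤ padicValNat 3 (Nat.card (AddCommGroup.primaryComponent (W.baseChange M).sha 3)) :=
  ⟨noRamificationBinder_of_lowerBSD3OverSolventQuartic,
    fun h ↦ lowerBSD3OverSolventQuartic_of_noRamificationBinder h⟩

end Summit.BirchSwinnertonDyer.BirchSwinnertonDyer.Theorems.LowerBSD3OverSolventQuartic

end
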